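import Summits.Ventures.PercRepro.S1KillCells
import Summits.Ventures.PercRepro.S1SeriesLever

/-!
# PercRepro — THE CELL `(8, 17)` OF THE `q = 4` WINDOW BY THE KILL LEVER (p2, gen 22; SUBCLAIM-S1 §6.6)

The cell `(8, 17)` (`n = 25` points): coloop-free (`c = 0`) by the KILL LEVER — at the actual triangle count
`t = s₃ ∈ [1, 61]` the cell form at the caps `(t, 963, 12855)` (`s₄ ≤ 963` = min(lever 972, gb 963) by the iterated
series-class lever, `s₅ ≤ 12855` by the five-circuit lever) with the kill of `mk t ≤ t` triangles on the
`Y`-side (`mk t·C(22, 5) − C(mk t, 2)·C(20, 3)` dependent `8`-sets), at `t = 0` by the four-circuit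
count `u = s₄`: `u ≤ 2` the plain form at the cap `2`, `u ≥ 3` the kill of `3` four-circuits (`3·C(21, 4) − 3·C(20, 3)`);
`1 ≤ c < 2` coloops by the exact coloop ladder on the lever caps (no kill needed), `c ≥ 2` by the lossy ladder.
Exact-integer twin mining/p2/g22/gencells22.py.

* `gb_cap_seventeen_25` — the series-class cap instantiated; `mkEightSeventeen` — the triangles used per `t`;
* **`c025_core_eight_seventeen`**.
Axioms: standard.
-/

open scoped Matroid

namespace PercRepro

namespace S1

open Set

variable {α : Type}

/-- `Φ(8, 4) = 76/15 ≤ 6`. -/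
theorem phiK_eight_four_le : phiK 8 4 ≤ 2 * ((2 : ℚ) ^ 2 - 1) := by
  simp only [phiK]
  rw [show Finset.Ioo 4 8 = {5, 6, 7} by decide]
  norm_num [Finset.sum_insert, Finset.sum_singleton, Finset.sum_div, Nat.choose]

/-- **The series-class cap at `(17, 25)`**: a coloop-free `e`-free core of nullity `17` on `25` points has `s₄ ≤ 963`. -/
theorem gb_cap_seventeen_25 : ∀ (N : Matroid α) [N.Finite],
    (∀ e ∈ N.E, ∃ A ⊆ N.E \ {e}, e ∉ N.closure A ∧ e ∉ N.closure ((N.E \ {e}) \ A)) →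
    N.E.encard = N.eRank + ((17 : ℕ) : ℕ∞) → N.E.ncard = 8 + 17 → N.coloops = ∅ →
    {C : Set α | N.IsCircuit C ∧ C.ncard = 4}.ncard ≤ 963 := by
  intro N _ hfree hd hn hcol
  have h := ncard_fourCircuits_le_gb_of_coloopFree N hfree hd hcol hn
  have hv : gb 17 (8 + 17) = 963 := by decide
  rwa [hv] at h

/-- The number of triangles used in the kill at each `t = s₃` (`mk t ≤ t`; `0` at `t = 0`). -/
def mkEightSeventeen (t : ℕ) : ℕ := [0,1,1,1,2,2,2,2,2,3,3,3,3,3,3,4,4,4,4,4,5,5,5,5,6,6,6,6,6,7,7,7,7,8,8,8,8,9,9,9,9,10,10,10,10,11,11,11,12,12,12,13,13,13,14,14,15,15,15,16,16,17].getD t 0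

/-- **THE CELL `(8, 17)`**: an `e`-free core of rank `8` with `25` points satisfies `RLS` at level `4` — by the
kill lever (`c = 0`), the exact coloop ladder (`1 ≤ c < 2`) and the lossy ladder (`c ≥ 2`). -/
theorem c025_core_eight_seventeen (M : Matroid α) [M.Finite] (hR : M.eRank = (8 : ℕ)) (hn : M.E.ncard = 25)
    (hfree : ∀ e ∈ M.E, ∃ A ⊆ M.E \ {e}, e ∉ M.closure A ∧ e ∉ M.closure ((M.E \ {e}) \ A)) :
    ThmN.RLS M 8 4 := by
  rcases (show M.coloops.ncard = 0 ∨ M.coloops.ncard = 1 ∨ 2 ≤ M.coloops.ncard by omega) with h | h | h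
  · have hc : M.coloops = ∅ := (Set.ncard_eq_zero (M.ground_finite.subset M.coloops_subset_ground)).1 h
    exact rls_of_kill_case_four M (p := 8) (d := 17) hR hn hfree hc (by norm_num) (by norm_num)
      (P := 61) (S := 963) (S5 := 12855) (by decide) gb_cap_seventeen_25 (by decide) mkEightSeventeen (by decide)
      (u₀ := 2) (m₀ := 3) (by norm_num) (by decide +kernel) (by decide +kernel) (by decide +kernel)
  · exact rls_of_ladder_case M (p := 7) (c := 1) (d := 17) (by norm_num) (by norm_num) hR hn hfree h
      (by norm_num) (by norm_num) (P := 61) (S := 980) (S5 := 12990) (by decide) (by decide) (by decide)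
      (by decide +kernel)
  · exact rls_of_coloops_lossy M (p := 6) (c := 2) (hR.trans (by norm_num)) (by norm_num) h phiK_eight_four_le

end S1

end PercRepro
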